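import Summits.CriticalPhenomena.PercolationContinuityZ3.Theorems.PercNearOneGluingNoHeavyPcintKernZ6S4Defs
import HarnessLib

/-!
# PCINT lane, kernel check 1/4 of the B2r window certificate `d = 6`, memory 4 (3-step windows, 1728 codes): codes `0 ≤ c < 432`

Cell `prim-pcint`, seat `prim-pcint-2` (gen 2).  Collatz–Wielandt rows `10^5 · row ≤ 99999 · DEN · v` for the window codes in
`[0, 432)`, by `decide +kernel` in chunks of `108` codes (natural-number arithmetic only; `maxHeartbeats 0`).
Does NOT build on p205010.
-/

namespace Summit.CriticalPhenomena.PercolationContinuityZ3.Theorems.Pcint.Z6S4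

set_option maxHeartbeats 0 in
/-- Rows `0 ≤ c < 108` of the certificate hold. [folklore] -/
theorem chk_0_108 : chk 0 108 = true := by decide +kernel

set_option maxHeartbeats 0 in
/-- Rows `108 ≤ c < 216` of the certificate hold. [folklore] -/
theorem chk_108_216 : chk 108 216 = true := by decide +kernel

set_option maxHeartbeats 0 in
/-- Rows `216 ≤ c < 324` of the certificate hold. [folklore] -/
theorem chk_216_324 : chk 216 324 = true := by decide +kernel

set_option maxHeartbeats 0 in
/-- Rows `324 ≤ c < 432` of the certificate hold. [folklore] -/
theorem chk_324_432 : chk 324 432 = true := by decide +kernel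

/-- Rows `0 ≤ c < 432` of the certificate hold. [folklore] -/
theorem chkFile_1 : chk 0 432 = true :=
  chk_split (chk_split (chk_split chk_0_108 chk_108_216) chk_216_324) chk_324_432

end Summit.CriticalPhenomena.PercolationContinuityZ3.Theorems.Pcint.Z6S4
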